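import Literature.Geometry.Kaehler.ComplexTorusNefConeGordan
import Literature.Geometry.Kaehler.ComplexTorusIdempotentRelations
import Literature.Geometry.Kaehler.ComplexTorusPicardNumberOneThetaDivisorIrreducible
import Literature.Geometry.Kaehler.ComplexTorusIsogenousCMPower
import Mathlib.Tactic.TFAE
import HarnessLib

/-!
# Bauer 1998, §1 Theorem, for every complex abelian variety: the nef cone is rational polyhedral
# (⟺ `N(X)` is finitely generated) iff `X ∼ X₁ × ⋯ × X_r` with mutually non-isogenous `Xᵢ`, `NS(Xᵢ) ≅ ℤ`;
# and Rosoff's statements (1), (2) of Bauer's introduction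

Layer `Literature/Geometry/Kaehler`, namespace `Literature.Geometry.Kaehler.ComplexTorus`; lane
`lit-hodgefound`, seat p07 (generation 45), programme «THE NEF CONE OF AN ABELIAN VARIETY», file 56 of the
seat lineage.  It ASSEMBLES Bauer's main theorem in its printed, existential form for an ARBITRARY complex
abelian variety `X` from the files of generation 44 — `ComplexTorusEffectiveClassesFiniteProduct` (file 54:
Thm. 4.2 along a given Poincaré decomposition `X ∼ ∏ X_ν^{n_ν}`), `ComplexTorusNefConeGordan` (file 55:
(ib) ⟺ (ic)), `ComplexTorusEffectiveClassesIsogeny` (file 51: Lemma 4.1), `ComplexTorusEffectiveClassesProduct`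
(file 53: two simple factors) — and the tree's Poincaré decomposition WITH NONZERO FACTORS
`IsRiemannForm.exists_isIsogenous_powers_pos` (`ComplexTorusIdempotentRelations`), `ρ(X) = 1 ⟹ X` simple
(`IsAbelianVariety.isSimple_of_finrank_neronSeveriGroup_eq_one`, `ComplexTorusPicardNumberOneThetaDivisorIrreducible`),
`ρ(∏ X_k) = Σ ρ(X_k)` when `Hom(X_k, X_l) = 0` (`finrank_neronSeveriGroup_sigmaPi_eq_sum_of_forall_ne`),
`ρ(X) = g² ⟺ X ∼ E^g` (`exists_isIsogenous_ellipticPow_of_finrank_neronSeveriGroup_eq_sq`,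
`ComplexTorusIsogenousCMPower`) and `ρ(X₁ × X₂) = ρ(X₁) + ρ(X₂) + rk Hom(X₂, X₁)`
(`IsAbelianVariety.finrank_neronSeveriGroup_prod`), all consumed BY NAME.  Theorems only (no definition, no
named fact, no instance, no notation; net debt `0`).

THE SOURCE (Th. Bauer, *On the cone of curves of an abelian variety*, Amer. J. Math. 120 (1998); held arXiv
alg-geom/9712019, p. 2), VERBATIM. "[Rosoff] shows: (1) If `X` is a singular abelian variety, i.e. if
`rk NS(X) = (dim X)²`, and if `dim X ≥ 2`, then `N(X)` is not finitely generated. (2) For elliptic curves `E₁`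
and `E₂`, `N(E₁ × E₂)` is finitely generated if and only if `rk NS(E₁ × E₂) = 2`. […] **Theorem.** Let `X` be
an abelian variety over the field of complex numbers. Then the following conditions are equivalent:
(ia) The closed cone of curves `NE̅(X)` is rational polyhedral. (ib) The nef cone `Nef(X)` is rational
polyhedral. (ic) The semi-group `N(X)` is finitely generated. (ii) `X` is isogenous to a product
`X₁ × ⋯ × X_r` of mutually non-isogenous abelian varieties `Xᵢ` with `NS(Xᵢ) ≅ ℤ` for `1 ≤ i ≤ r`. […]
Observe that the theorem of course contains statement (2) above, while statement (1) follows from the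
theorem plus the fact that by [ShiMit74] a singular abelian variety is isogenous to a product `Eⁿ` for some
elliptic curve `E`."

THIS FILE, in the tree's model (`NS(X) = {IsNSForm}`, `NS_ℝ(X) = span_ℝ NS(X)`,
`Nef(X) = {θ ∈ NS_ℝ(X) | H_θ ≥ 0}`, `N(X) = {η ∈ NS(X) | H_η ≥ 0}` — the semi-positive = effective = nef
classes —, "rational polyhedral" = `Σ ℝ≥0·sᵢ` for finitely many `sᵢ ∈ NS(X)`, a decomposition = an isogeny
of complex tori onto a dependent product `sigmaPiPeriod`):
* §1 `nonempty_of_finrank_neronSeveriGroup_ne_zero` — a torus with `NS(X) ≠ 0` is nonzero (on the zero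
  torus every `2`-form vanishes);
* §2 **(ii) ⟹ (ic), (ii) ⟹ (ib) IN THE PRINTED GENERALITY** — for an abelian variety `X ∼ ∏_k X_k` with
  mutually non-isogenous factors `X_k` (arbitrary tori of arbitrary dimensions) with `NS(X_k) ≅ ℤ`, `N(X)`
  is finitely generated and `Nef(X)` is rational polyhedral
  (`IsIsogenous.exists_finset_addSubmonoidClosure_eq_of_sigmaPi_of_finrank_eq_one`,
  `IsIsogenous.exists_finset_span_nnreal_eq_of_sigmaPi_of_finrank_eq_one`): the `X_k` are abelian varieties
  (factors of one), nonzero (§1) and SIMPLE (`ρ = 1`), so file 54's Thm. 4.2 applies; and the number of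
  factors is the Picard number, `ρ(X) = r` (`IsIsogenous.finrank_neronSeveriGroup_eq_card_of_sigmaPi_of_finrank_eq_one`);
* §3 **(ic) ⟹ (ii), (ic) ⟺ (ii), (ib) ⟺ (ii) FOR EVERY ABELIAN VARIETY**
  (`IsAbelianVariety.exists_isIsogenous_sigmaPi_of_addSubmonoidClosure_eq`: if `N(X)` is finitely generated
  then `X ∼ X₁ × ⋯ × X_r` with `r = ρ(X)` simple, nonzero, mutually non-isogenous abelian SUBVARIETIES
  `Xᵢ ⊆ X` with `NS(Xᵢ) ≅ ℤ` — the Poincaré decomposition `X ∼ ∏ X_ν^{n_ν}` has all `n_ν = 1` by Thm. 4.2;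
  `IsAbelianVariety.exists_finset_addSubmonoidClosure_eq_iff_exists_isIsogenous_sigmaPi`,
  `IsAbelianVariety.exists_finset_span_nnreal_eq_iff_exists_isIsogenous_sigmaPi`), and the printed
  **THEOREM (ib) ⟺ (ic) ⟺ (ii)** as one `TFAE` (`IsAbelianVariety.nefCone_polyhedral_tfae`); (ia), the closed
  cone of curves in `N₁(X)_ℝ`, is not modelled in the tree and is not part of the `TFAE`;
* §4 **ROSOFF'S STATEMENTS (1) AND (2)**: `not_exists_finset_addSubmonoidClosure_eq_of_finrank_neronSeveriGroup_eq_sq`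
  (a singular abelian variety of dimension `≥ 2` — `ρ(X) = g²`, hence `X ∼ E^g` — has non-finitely-generated
  `N(X)`: `N(E^g)` is not, file 54, and Lemma 4.1) and
  `exists_finset_addSubmonoidClosure_eq_prod_iff_finrank_neronSeveriGroup_eq_two` (for one-dimensional tori
  `E₁, E₂`: `N(E₁ × E₂)` finitely generated ⟺ `E₁ ≁ E₂` ⟺ `ρ(E₁ × E₂) = 2`).

## References

* [Bauer1998ConeOfCurves] Th. Bauer, *On the cone of curves of an abelian variety*, Amer. J. Math. 120 (1998)
  997–1006, §1 Theorem ((ib) ⟺ (ic) ⟺ (ii)) and statements (1), (2) of the introduction; §4 Thm. 4.2,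
  Lemma 4.1 (held: arXiv alg-geom/9712019, pp. 2, 5).
* [Rosoff1981EffectiveDivisorClasses] J. Rosoff, *Effective divisor classes and blowings-up of `ℙ²`*, Pacific
  J. Math. 89 (1980/81) 419–429 (Bauer's [Ros81]: statements (1), (2) and Lemma 4.1).
* [Lange2023AbelianVarietiesComplex] H. Lange, *Abelian Varieties over the Complex Numbers*, Springer 2023,
  §2.4.4 Thm. 2.4.25 (Poincaré's complete reducibility), §2.6.3 Exercise (2) (`ρ(X) = g² ⟺ X ∼ E^g`).
* [HulekLaface2019PicardNumbersAV] K. Hulek, R. Laface, *On the Picard numbers of abelian varieties*, Ann. Sc.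
  Norm. Super. Pisa Cl. Sci. (5) XIX (2019) 1199–1224, §2.1 Prop. 2.2, Cor. 2.3 (`ρ` of a product).
-/

noncomputable section

open scoped Manifold ComplexOrder NNReal
open Complex Set Function Module Filter Topology

namespace Literature.Geometry.Kaehler

namespace ComplexTorus

/-! ### §1 A torus with a nonzero Néron–Severi group is nonzero -/

section Nonzero

variable {ι : Type*} [Fintype ι] {E : Type*} [NormedAddCommGroup E] [NormedSpace ℂ E]
  (Φ : (ι → ℝ) ≃L[ℝ] E)

omit [Fintype ι] in
include Φ in
/-- On the zero torus (`ι` empty, `E = 0`) every real `2`-form vanishes. [folklore] -/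
private theorem twoForm_eq_zero_of_isEmpty [IsEmpty ι] (η : E [⋀^Fin 2]→L[ℝ] ℝ) : η = 0 := by
  haveI : Subsingleton E := Φ.symm.injective.subsingleton
  ext v
  have hv : v = 0 := Subsingleton.elim _ _
  rw [hv, ContinuousAlternatingMap.coe_zero, Pi.zero_apply]
  exact η.map_zero

omit [Fintype ι] in
/-- **A complex torus with `NS(X) ≠ 0` is nonzero**: if `rk NS(X) ≠ 0` then the lattice `ℤ^ι` is nonzero
(on the zero torus `NS = 0`).  In Bauer's (ii) the factors `Xᵢ` with `NS(Xᵢ) ≅ ℤ` are therefore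
positive-dimensional. [cite: Bauer1998ConeOfCurves, §1 Theorem (ii) ("abelian varieties `Xᵢ` with `NS(Xᵢ) ≅ ℤ`")] -/
theorem nonempty_of_finrank_neronSeveriGroup_ne_zero (h : finrank ℤ (neronSeveriGroup Φ) ≠ 0) :
    Nonempty ι := by
  by_contra hι
  haveI : IsEmpty ι := not_nonempty_iff.1 hι
  haveI : Subsingleton (neronSeveriGroup Φ) := ⟨fun a b ↦ Subtype.ext <| by
    rw [twoForm_eq_zero_of_isEmpty Φ (a : E [⋀^Fin 2]→L[ℝ] ℝ), twoForm_eq_zero_of_isEmpty Φ (b : E [⋀^Fin 2]→L[ℝ] ℝ)]⟩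
  exact h Module.finrank_zero_of_subsingleton

end Nonzero

/-! ### §2 (ii) ⟹ (ic) and (ii) ⟹ (ib), in the printed generality -/

section Decomposition

variable {κ : Type*} [Fintype κ] [DecidableEq κ] {σ : κ → Type*} [∀ k, Fintype (σ k)]
  [∀ k, DecidableEq (σ k)] {F : κ → Type*} [∀ k, NormedAddCommGroup (F k)] [∀ k, NormedSpace ℂ (F k)]
  (Ψ : ∀ k, (σ k → ℝ) ≃L[ℝ] F k)
  {ι : Type*} [Fintype ι] [DecidableEq ι] {E : Type*} [NormedAddCommGroup E] [NormedSpace ℂ E]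
  {Φ : (ι → ℝ) ≃L[ℝ] E}

/-- **The factors of Bauer's (ii) are nonzero simple abelian varieties**: if the abelian variety `X` is
isogenous to `∏_k X_k` with `NS(X_k) ≅ ℤ`, then every `X_k` is an abelian variety (a factor of one), nonzero,
and SIMPLE (`ρ(X_k) = 1`: a non-simple abelian variety `Y ∼ Y₁ × Y₂` has `ρ(Y) ≥ 2`).
[cite: Bauer1998ConeOfCurves, §1 Theorem (ii) and §4 (proof of Thm. 4.2: "the `Xᵢ` are simple")] [cite: Lange2023AbelianVarietiesComplex, §2.4.4 Thm. 2.4.25] -/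
theorem IsIsogenous.isSimple_and_isAbelianVariety_of_sigmaPi_of_finrank_eq_one
    (h : IsIsogenous Φ (sigmaPiPeriod Ψ)) (hA : IsAbelianVariety Φ)
    (hρ : ∀ k, finrank ℤ (neronSeveriGroup (Ψ k)) = 1) (k : κ) :
    Nonempty (σ k) ∧ IsSimple (Ψ k) ∧ IsAbelianVariety (Ψ k) := by
  have hAk : IsAbelianVariety (Ψ k) := ((h.isAbelianVariety_iff).1 hA).of_sigmaPi k
  exact ⟨nonempty_of_finrank_neronSeveriGroup_ne_zero (Ψ k) (by rw [hρ k]; exact one_ne_zero),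
    hAk.isSimple_of_finrank_neronSeveriGroup_eq_one (Ψ k) (hρ k), hAk⟩

/-- **(ii) ⟹ (ic), as printed**: if the abelian variety `X` "is isogenous to a product `X₁ × ⋯ × X_r` of
mutually non-isogenous abelian varieties `Xᵢ` with `NS(Xᵢ) ≅ ℤ`" (here: any finite family of complex tori
`X_k`, `k ∈ κ`, of any dimensions, pairwise non-isogenous, `rk NS(X_k) = 1`, and an isogeny `X ∼ ∏_k X_k`),
then the semigroup `N(X) = {η ∈ NS(X) | H_η ≥ 0}` of effective classes is finitely generated — the `X_k` are
nonzero simple abelian varieties, and Thm. 4.2 (file 54). [cite: Bauer1998ConeOfCurves, §1 Theorem ((ii) ⟹ (ic)) and §4 Thm. 4.2] -/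
theorem IsIsogenous.exists_finset_addSubmonoidClosure_eq_of_sigmaPi_of_finrank_eq_one
    (h : IsIsogenous Φ (sigmaPiPeriod Ψ)) (hA : IsAbelianVariety Φ)
    (hΨΨ : ∀ j k, j ≠ k → ¬ IsIsogenous (Ψ j) (Ψ k)) (hρ : ∀ k, finrank ℤ (neronSeveriGroup (Ψ k)) = 1) :
    ∃ S : Finset (E [⋀^Fin 2]→L[ℝ] ℝ),
      (AddSubmonoid.closure (S : Set (E [⋀^Fin 2]→L[ℝ] ℝ)) : Set (E [⋀^Fin 2]→L[ℝ] ℝ)) =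
        {η | IsNSForm Φ η ∧ ∀ v : E, 0 ≤ η ![I • v, v]} := by
  have hk := h.isSimple_and_isAbelianVariety_of_sigmaPi_of_finrank_eq_one Ψ hA hρ
  haveI : ∀ k, Nonempty (σ k) := fun k ↦ (hk k).1
  exact (h.exists_finset_addSubmonoidClosure_eq_iff_of_sigmaPi Ψ (fun k ↦ (hk k).2.1) fun k ↦ (hk k).2.2).2
    ⟨hΨΨ, hρ⟩

/-- **(ii) ⟹ (ib), as printed**: under the same hypothesis the nef cone
`Nef(X) = {θ ∈ NS_ℝ(X) | H_θ ≥ 0}` is rational polyhedral — generated, as a convex cone, by finitely many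
classes of `NS(X)` ((ii) ⟹ (ic) and file 55's (ic) ⟹ (ib)).
[cite: Bauer1998ConeOfCurves, §1 Theorem ((ii) ⟹ (ib)) and §4 ("By Gordon's Lemma …")] -/
theorem IsIsogenous.exists_finset_span_nnreal_eq_of_sigmaPi_of_finrank_eq_one
    (h : IsIsogenous Φ (sigmaPiPeriod Ψ)) (hA : IsAbelianVariety Φ)
    (hΨΨ : ∀ j k, j ≠ k → ¬ IsIsogenous (Ψ j) (Ψ k)) (hρ : ∀ k, finrank ℤ (neronSeveriGroup (Ψ k)) = 1) :
    ∃ S : Finset (E [⋀^Fin 2]→L[ℝ] ℝ), (∀ η ∈ S, IsNSForm Φ η) ∧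
      (Submodule.span ℝ≥0 (S : Set (E [⋀^Fin 2]→L[ℝ] ℝ)) : Set (E [⋀^Fin 2]→L[ℝ] ℝ)) =
        {θ | θ ∈ Submodule.span ℝ {η : E [⋀^Fin 2]→L[ℝ] ℝ | IsNSForm Φ η} ∧ ∀ v : E, 0 ≤ θ ![I • v, v]} := by
  obtain ⟨S, hS⟩ := h.exists_finset_addSubmonoidClosure_eq_of_sigmaPi_of_finrank_eq_one Ψ hA hΨΨ hρ
  exact hA.exists_finset_span_nnreal_eq_of_addSubmonoidClosure_eq Φ hS

/-- **In (ii) the number of factors is the Picard number**: `ρ(X) = ρ(∏_k X_k) = Σ_k ρ(X_k) = r`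
(`Hom(X_k, X_l) = 0` for non-isogenous simple factors, so `NS_ℚ(∏ Xᵢ) ≅ ⊕ NS_ℚ(Xᵢ)`).
[cite: Bauer1998ConeOfCurves, §4 Thm. 4.2 (proof: "`NS_ℚ(∏ Xᵢ) ≅ … ≅ ⊕ NS_ℚ(Xᵢ)`")] [cite: HulekLaface2019PicardNumbersAV, §2.1 Cor. 2.3] -/
theorem IsIsogenous.finrank_neronSeveriGroup_eq_card_of_sigmaPi_of_finrank_eq_one
    (h : IsIsogenous Φ (sigmaPiPeriod Ψ)) (hA : IsAbelianVariety Φ)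
    (hΨΨ : ∀ j k, j ≠ k → ¬ IsIsogenous (Ψ j) (Ψ k)) (hρ : ∀ k, finrank ℤ (neronSeveriGroup (Ψ k)) = 1) :
    finrank ℤ (neronSeveriGroup Φ) = Fintype.card κ := by
  have hk := h.isSimple_and_isAbelianVariety_of_sigmaPi_of_finrank_eq_one Ψ hA hρ
  rw [h.finrank_neronSeveriGroup_eq Φ (sigmaPiPeriod Ψ),
    finrank_neronSeveriGroup_sigmaPi_eq_sum_of_forall_ne Ψ (fun k ↦ (hk k).2.2)
      fun j k hjk ↦ (hk j).2.1.homRat_eq_bot (hk k).2.1 (hΨΨ j k hjk)]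
  simp only [hρ, Finset.sum_const, Finset.card_univ, smul_eq_mul, mul_one]

end Decomposition

/-! ### §3 (ic) ⟺ (ii) and (ib) ⟺ (ii) for every abelian variety; the Theorem as a `TFAE` -/

section EveryAbelianVariety

variable {ι : Type*} [Fintype ι] [DecidableEq ι] {E : Type*} [NormedAddCommGroup E] [NormedSpace ℂ E]
  {A : (ι → ℝ) ≃L[ℝ] E}

/-- **(ic) ⟹ (ii), for every abelian variety, with the factors inside `X`**: if `N(X)` is finitely
generated then `X` is isogenous to the product `X₁ × ⋯ × X_r` of `r = ρ(X)` complex sub-tori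
`Xᵢ = Y_{Vᵢ} ⊆ X` which are NONZERO, SIMPLE, pairwise NON-ISOGENOUS abelian varieties with `NS(Xᵢ) ≅ ℤ`.
Proof: Poincaré's complete reducibility gives `X ∼ ∏_ν X_ν^{n_ν}` with nonzero simple pairwise
non-isogenous sub-tori `X_ν` and `n_ν ≥ 1`; by Thm. 4.2 (file 54) all `n_ν = 1` and `NS(X_ν) ≅ ℤ`, and
`X_ν¹ ≅ X_ν`. [cite: Bauer1998ConeOfCurves, §1 Theorem ((ic) ⟹ (ii)) and §4 Thm. 4.2] [cite: Lange2023AbelianVarietiesComplex, §2.4.4 Thm. 2.4.25] -/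
theorem IsAbelianVariety.exists_isIsogenous_sigmaPi_of_addSubmonoidClosure_eq (hAV : IsAbelianVariety A)
    {S : Finset (E [⋀^Fin 2]→L[ℝ] ℝ)}
    (hS : (AddSubmonoid.closure (S : Set (E [⋀^Fin 2]→L[ℝ] ℝ)) : Set (E [⋀^Fin 2]→L[ℝ] ℝ)) =
      {η | IsNSForm A η ∧ ∀ v : E, 0 ≤ η ![I • v, v]}) :
    ∃ (r : ℕ) (V : Fin r → Submodule ℝ (ι → ℝ)) (hV : ∀ ν, IsLatticeSubspace (V ν))
      (hVc : ∀ ν, IsComplexSubspace A (V ν)),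
      finrank ℤ (neronSeveriGroup A) = r ∧
      (∀ ν, 0 < subRank (V ν)) ∧
      (∀ ν, IsSimple (subtorusPeriod A (V ν) (hV ν) (hVc ν))) ∧
      (∀ ν, IsAbelianVariety (subtorusPeriod A (V ν) (hV ν) (hVc ν))) ∧
      (∀ ν ν', ν ≠ ν' → ¬ IsIsogenous (subtorusPeriod A (V ν) (hV ν) (hVc ν))
        (subtorusPeriod A (V ν') (hV ν') (hVc ν'))) ∧
      (∀ ν, finrank ℤ (neronSeveriGroup (subtorusPeriod A (V ν) (hV ν) (hVc ν))) = 1) ∧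
      IsIsogenous A (sigmaPiPeriod fun ν ↦ subtorusPeriod A (V ν) (hV ν) (hVc ν)) := by
  classical
  obtain ⟨ω, hω⟩ := hAV
  obtain ⟨r, V, hV, hVc, n, hpos, hXs, hXA, hXX, hn, hiso⟩ := hω.exists_isIsogenous_powers_pos A
  haveI : ∀ ν, Nonempty (Fin (subRank (V ν))) := fun ν ↦ ⟨⟨0, hpos ν⟩⟩
  have h42 := (hiso.exists_finset_addSubmonoidClosure_eq_iff_of_powers
    (fun ν ↦ subtorusPeriod A (V ν) (hV ν) (hVc ν)) n hXs hXA hXX hn).1 ⟨S, hS⟩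
  have hn1 : n = fun _ ↦ 1 := funext fun ν ↦ (h42 ν).2
  subst hn1
  have hiso' : IsIsogenous A (sigmaPiPeriod fun ν ↦ subtorusPeriod A (V ν) (hV ν) (hVc ν)) :=
    IsIsogenous.trans _ _ _ hiso
      (IsIsogenous.sigmaPi _ _ fun ν ↦ (isIsomorphic_powPeriod_one (subtorusPeriod A (V ν) (hV ν) (hVc ν))).symm.isIsogenous)
  refine ⟨r, V, hV, hVc, ?_, hpos, hXs, hXA, hXX, fun ν ↦ (h42 ν).1, hiso'⟩
  rw [hiso'.finrank_neronSeveriGroup_eq_card_of_sigmaPi_of_finrank_eq_one _ ⟨ω, hω⟩ hXX fun ν ↦ (h42 ν).1,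
    Fintype.card_fin]

/-- **Bauer's Theorem, (ic) ⟺ (ii), for every complex abelian variety `X`.** "`N(X)` is finitely generated"
if and only if "`X` is isogenous to a product `X₁ × ⋯ × X_r` of mutually non-isogenous abelian varieties
`Xᵢ` with `NS(Xᵢ) ≅ ℤ`" — the `Xᵢ` realised as complex sub-tori `Y_{Vᵢ}` of `X` (⟹: the previous theorem;
⟸: §2, for any family of factors). [cite: Bauer1998ConeOfCurves, §1 Theorem ((ic) ⟺ (ii))] -/
theorem IsAbelianVariety.exists_finset_addSubmonoidClosure_eq_iff_exists_isIsogenous_sigmaPi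
    (hAV : IsAbelianVariety A) :
    (∃ S : Finset (E [⋀^Fin 2]→L[ℝ] ℝ),
        (AddSubmonoid.closure (S : Set (E [⋀^Fin 2]→L[ℝ] ℝ)) : Set (E [⋀^Fin 2]→L[ℝ] ℝ)) =
          {η | IsNSForm A η ∧ ∀ v : E, 0 ≤ η ![I • v, v]}) ↔
      ∃ (r : ℕ) (V : Fin r → Submodule ℝ (ι → ℝ)) (hV : ∀ ν, IsLatticeSubspace (V ν))
        (hVc : ∀ ν, IsComplexSubspace A (V ν)),
        (∀ ν ν', ν ≠ ν' → ¬ IsIsogenous (subtorusPeriod A (V ν) (hV ν) (hVc ν))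
          (subtorusPeriod A (V ν') (hV ν') (hVc ν'))) ∧
        (∀ ν, finrank ℤ (neronSeveriGroup (subtorusPeriod A (V ν) (hV ν) (hVc ν))) = 1) ∧
        IsIsogenous A (sigmaPiPeriod fun ν ↦ subtorusPeriod A (V ν) (hV ν) (hVc ν)) := by
  constructor
  · rintro ⟨S, hS⟩
    obtain ⟨r, V, hV, hVc, -, -, -, -, hXX, hρ, hiso⟩ :=
      hAV.exists_isIsogenous_sigmaPi_of_addSubmonoidClosure_eq hS
    exact ⟨r, V, hV, hVc, hXX, hρ, hiso⟩
  · rintro ⟨r, V, hV, hVc, hXX, hρ, hiso⟩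
    exact hiso.exists_finset_addSubmonoidClosure_eq_of_sigmaPi_of_finrank_eq_one _ hAV hXX hρ

/-- **Bauer's Theorem, (ib) ⟺ (ii), for every complex abelian variety `X`**: the nef cone
`Nef(X) = {θ ∈ NS_ℝ(X) | H_θ ≥ 0}` is rational polyhedral iff `X ∼ X₁ × ⋯ × X_r` with mutually
non-isogenous `Xᵢ` (sub-tori of `X`) with `NS(Xᵢ) ≅ ℤ` ((ib) ⟺ (ic), file 55, and the previous theorem).
[cite: Bauer1998ConeOfCurves, §1 Theorem ((ib) ⟺ (ii))] -/
theorem IsAbelianVariety.exists_finset_span_nnreal_eq_iff_exists_isIsogenous_sigmaPi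
    (hAV : IsAbelianVariety A) :
    (∃ S : Finset (E [⋀^Fin 2]→L[ℝ] ℝ), (∀ η ∈ S, IsNSForm A η) ∧
        (Submodule.span ℝ≥0 (S : Set (E [⋀^Fin 2]→L[ℝ] ℝ)) : Set (E [⋀^Fin 2]→L[ℝ] ℝ)) =
          {θ | θ ∈ Submodule.span ℝ {η : E [⋀^Fin 2]→L[ℝ] ℝ | IsNSForm A η} ∧ ∀ v : E, 0 ≤ θ ![I • v, v]}) ↔
      ∃ (r : ℕ) (V : Fin r → Submodule ℝ (ι → ℝ)) (hV : ∀ ν, IsLatticeSubspace (V ν))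
        (hVc : ∀ ν, IsComplexSubspace A (V ν)),
        (∀ ν ν', ν ≠ ν' → ¬ IsIsogenous (subtorusPeriod A (V ν) (hV ν) (hVc ν))
          (subtorusPeriod A (V ν') (hV ν') (hVc ν'))) ∧
        (∀ ν, finrank ℤ (neronSeveriGroup (subtorusPeriod A (V ν) (hV ν) (hVc ν))) = 1) ∧
        IsIsogenous A (sigmaPiPeriod fun ν ↦ subtorusPeriod A (V ν) (hV ν) (hVc ν)) := by
  rw [hAV.exists_finset_span_nnreal_eq_iff_exists_finset_addSubmonoidClosure_eq A]
  exact hAV.exists_finset_addSubmonoidClosure_eq_iff_exists_isIsogenous_sigmaPi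

/-- **Bauer 1998, §1 Theorem, (ib) ⟺ (ic) ⟺ (ii).** "Let `X` be an abelian variety over the field of complex
numbers. Then the following conditions are equivalent: […] (ib) The nef cone `Nef(X)` is rational
polyhedral. (ic) The semi-group `N(X)` is finitely generated. (ii) `X` is isogenous to a product
`X₁ × ⋯ × X_r` of mutually non-isogenous abelian varieties `Xᵢ` with `NS(Xᵢ) ≅ ℤ` for `1 ≤ i ≤ r`."
In the tree's model: `Nef(X) = {θ ∈ NS_ℝ(X) | H_θ ≥ 0}` is the `ℝ≥0`-span of finitely many classes of
`NS(X)` ⟺ `N(X) = {η ∈ NS(X) | H_η ≥ 0}` is the submonoid generated by a finite set ⟺ there are pairwise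
non-isogenous complex sub-tori `Xᵢ = Y_{Vᵢ}` (`i < r`) with `rk NS(Xᵢ) = 1` and an isogeny
`X ∼ X₁ × ⋯ × X_r`.  ((ia), the closed cone of curves in `N₁(X)_ℝ`, is not modelled here.)
[cite: Bauer1998ConeOfCurves, §1 Theorem ((ib) ⟺ (ic) ⟺ (ii))] -/
theorem IsAbelianVariety.nefCone_polyhedral_tfae (hAV : IsAbelianVariety A) :
    List.TFAE
      [ ∃ S : Finset (E [⋀^Fin 2]→L[ℝ] ℝ), (∀ η ∈ S, IsNSForm A η) ∧
          (Submodule.span ℝ≥0 (S : Set (E [⋀^Fin 2]→L[ℝ] ℝ)) : Set (E [⋀^Fin 2]→L[ℝ] ℝ)) =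
            {θ | θ ∈ Submodule.span ℝ {η : E [⋀^Fin 2]→L[ℝ] ℝ | IsNSForm A η} ∧ ∀ v : E, 0 ≤ θ ![I • v, v]},
        ∃ S : Finset (E [⋀^Fin 2]→L[ℝ] ℝ),
          (AddSubmonoid.closure (S : Set (E [⋀^Fin 2]→L[ℝ] ℝ)) : Set (E [⋀^Fin 2]→L[ℝ] ℝ)) =
            {η | IsNSForm A η ∧ ∀ v : E, 0 ≤ η ![I • v, v]},
        ∃ (r : ℕ) (V : Fin r → Submodule ℝ (ι → ℝ)) (hV : ∀ ν, IsLatticeSubspace (V ν))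
          (hVc : ∀ ν, IsComplexSubspace A (V ν)),
          (∀ ν ν', ν ≠ ν' → ¬ IsIsogenous (subtorusPeriod A (V ν) (hV ν) (hVc ν))
            (subtorusPeriod A (V ν') (hV ν') (hVc ν'))) ∧
          (∀ ν, finrank ℤ (neronSeveriGroup (subtorusPeriod A (V ν) (hV ν) (hVc ν))) = 1) ∧
          IsIsogenous A (sigmaPiPeriod fun ν ↦ subtorusPeriod A (V ν) (hV ν) (hVc ν)) ] := by
  tfae_have 1 ↔ 2 := hAV.exists_finset_span_nnreal_eq_iff_exists_finset_addSubmonoidClosure_eq A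
  tfae_have 2 ↔ 3 := hAV.exists_finset_addSubmonoidClosure_eq_iff_exists_isIsogenous_sigmaPi
  tfae_finish

end EveryAbelianVariety

/-! ### §4 Rosoff's statements (1) and (2) of Bauer's introduction -/

section Rosoff

variable {ι : Type*} [Fintype ι] [DecidableEq ι] {E : Type*} [NormedAddCommGroup E] [NormedSpace ℂ E]
  (Φ : (ι → ℝ) ≃L[ℝ] E)

omit [DecidableEq ι] in
/-- The covering space of a complex torus is finite-dimensional. [cite: Lange2023AbelianVarietiesComplex, §1.1.1] -/
private theorem finiteDimensional_complex₅₆ (Φ : (ι → ℝ) ≃L[ℝ] E) : FiniteDimensional ℂ E := by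
  haveI : FiniteDimensional ℝ E := LinearEquiv.finiteDimensional Φ.toLinearEquiv
  exact Module.Finite.of_restrictScalars_finite ℝ ℂ E

/-- **Statement (1) (Rosoff): on a singular abelian variety of dimension `≥ 2` the semigroup `N(X)` is not
finitely generated.** "If `X` is a singular abelian variety, i.e. if `rk NS(X) = (dim X)²`, and if
`dim X ≥ 2`, then `N(X)` is not finitely generated" — "statement (1) follows from the theorem plus the fact
that by [ShiMit74] a singular abelian variety is isogenous to a product `Eⁿ` for some elliptic curve `E`":
here `ρ(X) = g²` gives `X ∼ E_τ^g` (`exists_isIsogenous_ellipticPow_of_finrank_neronSeveriGroup_eq_sq`), `X`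
and hence `E_τ` is an abelian variety, `N(E_τ^g)` is not finitely generated for `g ≥ 2` (file 54, Prop. 3.1)
and finite generation is an isogeny invariant (Lemma 4.1). A complex torus with `ρ = g²` is automatically an
abelian variety, so no projectivity hypothesis is needed. [cite: Bauer1998ConeOfCurves, §1 statement (1) and the remark after the Theorem]
[cite: Lange2023AbelianVarietiesComplex, §2.6.3 Exercise (2) ((i) ⟹ (ii))] -/
theorem not_exists_finset_addSubmonoidClosure_eq_of_finrank_neronSeveriGroup_eq_sq
    (hρ : finrank ℤ (neronSeveriGroup Φ) = (finrank ℂ E) ^ 2) (hg : 2 ≤ finrank ℂ E) :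
    ¬ ∃ S : Finset (E [⋀^Fin 2]→L[ℝ] ℝ),
      (AddSubmonoid.closure (S : Set (E [⋀^Fin 2]→L[ℝ] ℝ)) : Set (E [⋀^Fin 2]→L[ℝ] ℝ)) =
        {η | IsNSForm Φ η ∧ ∀ v : E, 0 ≤ η ![I • v, v]} := by
  obtain ⟨τ, hτ, -, hiso⟩ := exists_isIsogenous_ellipticPow_of_finrank_neronSeveriGroup_eq_sq Φ hg hρ
  have hX : IsAbelianVariety Φ := isAbelianVariety_of_finrank_neronSeveriGroup_eq_sq Φ hρ
  have hEg : IsAbelianVariety (powPeriod (ellipticPeriod hτ) (finrank ℂ E)) := (hiso.isAbelianVariety_iff).1 hX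
  have hE : IsAbelianVariety (ellipticPeriod hτ) := IsAbelianVariety.of_pow (by omega) hEg
  rw [hiso.exists_finset_addSubmonoidClosure_eq_iff Φ (powPeriod (ellipticPeriod hτ) (finrank ℂ E))]
  exact hE.not_exists_finset_addSubmonoidClosure_eq_powPeriod (ellipticPeriod hτ) hg

variable {ι₁ ι₂ : Type*} [Fintype ι₁] [Fintype ι₂] [DecidableEq ι₁] [DecidableEq ι₂] {E₁ E₂ : Type*}
  [NormedAddCommGroup E₁] [NormedSpace ℂ E₁] [NormedAddCommGroup E₂] [NormedSpace ℂ E₂]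
  (Φ₁ : (ι₁ → ℝ) ≃L[ℝ] E₁) (Φ₂ : (ι₂ → ℝ) ≃L[ℝ] E₂)

omit [DecidableEq ι₁] in
/-- **An elliptic curve (a one-dimensional complex torus) is a nonzero simple abelian variety with
`NS ≅ ℤ`.** [cite: Bauer1998ConeOfCurves, §1 statement (2) ("for elliptic curves `E₁` and `E₂`")]
[cite: Lange2023AbelianVarietiesComplex, §2.6.3 Exercise (2) (the case `g = 1`: `ρ(E) = 1 = g²`)] -/
theorem isSimple_and_isAbelianVariety_of_finrank_eq_one (h1 : finrank ℂ E₁ = 1) :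
    Nontrivial E₁ ∧ IsSimple Φ₁ ∧ IsAbelianVariety Φ₁ ∧ finrank ℤ (neronSeveriGroup Φ₁) = 1 := by
  haveI := finiteDimensional_complex₅₆ Φ₁
  have hρ : finrank ℤ (neronSeveriGroup Φ₁) = 1 := finrank_neronSeveriGroup_eq_one_of_finrank_eq_one Φ₁ h1
  have hcard : Fintype.card ι₁ = 2 := by rw [card_eq_two_mul_finrank Φ₁, h1]
  refine ⟨Module.nontrivial_of_finrank_eq_succ (R := ℂ) h1, isSimple_of_card_eq_two Φ₁ hcard,
    isAbelianVariety_of_finrank_neronSeveriGroup_eq_sq Φ₁ (by rw [hρ, h1]; norm_num), hρ⟩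

/-- **Two elliptic curves are isogenous iff `Hom(E₂, E₁) ≠ 0`** (⟹: `rk Hom_ℚ(E₂, E₁) = rk End_ℚ(E₂) ≥ 1`
along the isogeny; ⟸: one-dimensional tori are simple, and `Hom = 0` between non-isogenous simple tori).
[cite: Lange2023AbelianVarietiesComplex, §1.1.2 Cor. 1.1.16 and §2.4.4 Cor. 2.4.26 (proof)] -/
theorem isIsogenous_iff_homRat_ne_bot_of_finrank_eq_one (h1 : finrank ℂ E₁ = 1) (h2 : finrank ℂ E₂ = 1) :
    IsIsogenous Φ₁ Φ₂ ↔ homRat Φ₂ Φ₁ ≠ ⊥ := by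
  have hE₁ := isSimple_and_isAbelianVariety_of_finrank_eq_one Φ₁ h1
  have hE₂ := isSimple_and_isAbelianVariety_of_finrank_eq_one Φ₂ h2
  haveI := finiteDimensional_complex₅₆ Φ₂
  haveI : Nonempty ι₂ := by
    have h := card_eq_two_mul_finrank Φ₂
    rw [h2] at h
    exact Fintype.card_pos_iff.1 (by omega)
  refine ⟨fun h ↦ ?_, fun h ↦ ?_⟩
  · rw [Ne, ← Submodule.finrank_eq_zero, IsIsogenous.finrank_homRat_eq_right Φ₂ h, finrank_homRat_self]
    have := one_le_finrank_endAlgRat Φ₂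
    omega
  · by_contra hni
    exact h (hE₂.2.1.homRat_eq_bot hE₁.2.1 fun h' ↦ hni (IsIsogenous.symm _ _ h'))

/-- **Statement (2) (Rosoff), as printed: "For elliptic curves `E₁` and `E₂`, `N(E₁ × E₂)` is finitely
generated if and only if `rk NS(E₁ × E₂) = 2`."** For one-dimensional complex tori `E₁, E₂` (nonzero simple
abelian varieties with `NS ≅ ℤ`): `N(E₁ × E₂)` is finitely generated ⟺ `E₁ ≁ E₂` (Thm. 4.2 for two simple
factors, file 53) ⟺ `Hom(E₂, E₁) = 0` ⟺ `ρ(E₁ × E₂) = ρ(E₁) + ρ(E₂) + rk Hom(E₂, E₁) = 2`.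
[cite: Bauer1998ConeOfCurves, §1 statement (2) and the remark after the Theorem ("the theorem of course contains statement (2)")]
[cite: HulekLaface2019PicardNumbersAV, §2.1 Prop. 2.2 (`ρ(X₁ × X₂) = ρ(X₁) + ρ(X₂) + rk Hom`)] -/
theorem exists_finset_addSubmonoidClosure_eq_prod_iff_finrank_neronSeveriGroup_eq_two
    (h1 : finrank ℂ E₁ = 1) (h2 : finrank ℂ E₂ = 1) :
    (∃ S : Finset ((E₁ × E₂) [⋀^Fin 2]→L[ℝ] ℝ),
        (AddSubmonoid.closure (S : Set ((E₁ × E₂) [⋀^Fin 2]→L[ℝ] ℝ)) : Set ((E₁ × E₂) [⋀^Fin 2]→L[ℝ] ℝ)) =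
          {θ | IsNSForm (prodPeriod Φ₁ Φ₂) θ ∧ ∀ v : E₁ × E₂, 0 ≤ θ ![I • v, v]}) ↔
      finrank ℤ (neronSeveriGroup (prodPeriod Φ₁ Φ₂)) = 2 := by
  obtain ⟨hN₁, hS₁, hA₁, hρ₁⟩ := isSimple_and_isAbelianVariety_of_finrank_eq_one Φ₁ h1
  obtain ⟨hN₂, hS₂, hA₂, hρ₂⟩ := isSimple_and_isAbelianVariety_of_finrank_eq_one Φ₂ h2
  rw [hS₁.exists_finset_addSubmonoidClosure_eq_prod_iff Φ₁ Φ₂ hS₂ hA₁ hA₂,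
    hA₁.finrank_neronSeveriGroup_prod Φ₂, hρ₁, hρ₂, isIsogenous_iff_homRat_ne_bot_of_finrank_eq_one Φ₁ Φ₂ h1 h2,
    not_ne_iff]
  constructor
  · rintro ⟨h, -, -⟩
    rw [h, finrank_bot]
  · intro h
    exact ⟨(Submodule.finrank_eq_zero).1 (by omega), rfl, rfl⟩

/-- **Statement (2), isogeny form**: for one-dimensional complex tori, `N(E₁ × E₂)` is finitely generated
iff `E₁` and `E₂` are NOT isogenous. [cite: Bauer1998ConeOfCurves, §1 statement (2) and §4 Thm. 4.2] -/
theorem exists_finset_addSubmonoidClosure_eq_prod_iff_not_isIsogenous_of_finrank_eq_one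
    (h1 : finrank ℂ E₁ = 1) (h2 : finrank ℂ E₂ = 1) :
    (∃ S : Finset ((E₁ × E₂) [⋀^Fin 2]→L[ℝ] ℝ),
        (AddSubmonoid.closure (S : Set ((E₁ × E₂) [⋀^Fin 2]→L[ℝ] ℝ)) : Set ((E₁ × E₂) [⋀^Fin 2]→L[ℝ] ℝ)) =
          {θ | IsNSForm (prodPeriod Φ₁ Φ₂) θ ∧ ∀ v : E₁ × E₂, 0 ≤ θ ![I • v, v]}) ↔
      ¬ IsIsogenous Φ₁ Φ₂ := by
  obtain ⟨hN₁, hS₁, hA₁, hρ₁⟩ := isSimple_and_isAbelianVariety_of_finrank_eq_one Φ₁ h1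
  obtain ⟨hN₂, hS₂, hA₂, hρ₂⟩ := isSimple_and_isAbelianVariety_of_finrank_eq_one Φ₂ h2
  rw [hS₁.exists_finset_addSubmonoidClosure_eq_prod_iff Φ₁ Φ₂ hS₂ hA₁ hA₂]
  exact ⟨fun h ↦ h.1, fun h ↦ ⟨h, hρ₁, hρ₂⟩⟩

end Rosoff

end ComplexTorus

end Literature.Geometry.Kaehler

end
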